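import Literature.MathematicalPhysics.QuantumFieldTheory.Balaban1983to89.B1Eq324BenfattoSect5LedgerDischarge
import HarnessLib

/-!
# `Balaban1983to89.B1Eq324BenfattoKernelSect5LedgerCumulant` — [BenfattoEtAl1978] p. 152 (4.7), p. 159 «Collecting all the errors», for the class of
# [Balaban1985BackgroundPropagators] Sect. E p. 428: the closed CUMULANT SIDE of the class pavement step (`…KernelSect5StepBound.exists_lower_step` conj 2,
# `…KernelSect5IdErrBounds`) ATOM BY ATOM in the ledger's currency, with the class propagator letter `K₀` entering through the row `K₀ ≤ C_K0·b` — PROVED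

statement-level skeleton of published theorems with citation tags; proofs where landed; nothing here is a claim about the
Yang–Mills mass gap

WHY THIS MODULE (cell `pub-ymgap`, seat `dag-n08-b` gen 13; node N08 [Balaban1985UV3]; own lineage = `…Sect5LedgerDischargeCumulant` (g6, module 2)).
The closed cumulant side of print's step has six displayed terms (a) `|Ê₀^T(H_J) − Ê₀^T(X)|`, (b) = (d) the (5.34)-type removals, (c) the same for
`H_{Γ̄₁}`, (e) CROSS, (f) `W₂₉`, each carrying the Appendix-D prefactor `Φ = 2^{(k+1)D}2^{2^{(k+1)D}}(max 1 C₀₀)^{(k+1)D}` with print's CONSTANT `C₀₀`;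
`…LedgerDischargeCumulant.cum_a_le … cum_f_le` absorb them with `Φ` inside the closed constant.  The class edition (seat n08-c's kernel `…IdErrBounds` /
`exists_lower_step`, «`max 1 C₀₀ ↦ K₀`») carries instead `Φ_K = 2^{(k+1)D}2^{2^{(k+1)D}}K₀^{(k+1)D}` where the letter `K₀` is tied BELOW by the centre
bound `K_u ∝ γb` (`hKuK : K_u ≤ K₀` in `exists_lower_step`; seat n08-d's instantiation `K₀ := max(max 1 (1/(γ_A−J_c)), K_u)`): `K₀` grows linearly with
the cut-off, so `Φ_K` is NOT a constant and the print atoms do not apply verbatim.  This file re-proves the five atoms with the ROW `0 ≤ K₀ ≤ C_K0·b`: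
`Φ_K ≤ Φ_C·b^{(k+1)D}`, `Φ_C = 2^{(k+1)D}2^{2^{(k+1)D}}C_K0^{(k+1)D}`, the extra `b^{(k+1)D}` absorbed by the same decay atom (factorial slot
`q ↦ q + (k+1)D`).  The structural atoms `e₅₁₁`/`e₅₃₄` are `K₀`-free (`struct₁_le`, `struct₂_le` apply by name).

WHAT IS PROVED (theorems only; no definition, no named fact, no `sorry`; axioms standard): ★ `cum_a_class_le`, ★ `cum_b_class_le` (serves (b) and (d)),
★ `cum_c_class_le`, ★★ `cum_e_class_le` (CROSS), ★ `cum_f_class_le` — the statements of `…LedgerDischargeCumulant.cum_*_le` with `(max 1 C₀₀)` replaced by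
the letter `K₀` on the left, by `C_K0` (and the factorial slot widened by `(k+1)D`) in the closed constant, under the extra rows `0 ≤ K₀ ≤ C_K0·b`.

HONEST SCOPE / NOT HERE.  Real inequalities between displayed closed terms; no measure theory; the class ledger packs, the sum over the steps and the
∃-knit are NOT here; no generalised Basic Lemma is stated; count-neutral for N08; nothing of [Balaban1985UV3] (41)/(47)/(5) is asserted; nothing about
d = 4, the continuum, OS axioms, a mass gap or the Clay problem.
-/

noncomputable section

open Finset
open scoped BigOperators Nat

namespace Literature.MathematicalPhysics.QuantumFieldTheory.Balaban1983to89.B1Eq324BenfattoKernelSect5LedgerCumulant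

open Literature.MathematicalPhysics.QuantumFieldTheory.Balaban1983to89.B1Eq324BenfattoLemma
open Literature.MathematicalPhysics.QuantumFieldTheory.Balaban1983to89.B1Eq324BenfattoSect5ErrTermLedger
open Literature.MathematicalPhysics.QuantumFieldTheory.Balaban1983to89.B1Eq324BenfattoSect5Eq511 (decayConst s1Const)
open Literature.MathematicalPhysics.QuantumFieldTheory.Balaban1983to89.B1Eq324BenfattoSect5LedgerDischarge

/-! ## §1  The closed cumulant side of the class step, atom by atom, with the row `K₀ ≤ C_K0·b` -/

section CumulantAtoms

variable {s D d t : ℕ} {κ A b δ ρ₁ ρ₂ ρ₃ ρ₄ b₀ M N nI K₀ CK0 : ℝ} {L w v : ℕ}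

/-- The geometric factor `2/(1 − e^{−x})·e^{x}` is `≥ 0` for `x ≥ 0`. [folklore] -/
private theorem geom_nonneg' {x : ℝ} (hx : 0 ≤ x) : 0 ≤ 2 / (1 - Real.exp (-x)) * Real.exp x := by
  refine mul_nonneg (div_nonneg (by norm_num) ?_) (Real.exp_pos _).le
  have : Real.exp (-x) ≤ 1 := Real.exp_le_one_iff.mpr (by linarith)
  linarith

set_option maxHeartbeats 400000 in -- long `calc`/closed-term elaboration (ops-buildfix 2026-08-27: keep ≥ 2× headroom)
/-- **ATOM (a) — the `|Ê₀^T(H_J) − Ê₀^T(X)|` term of the closed cumulant side: `2^{k+1}Φ·(A·E·e^{−(ϰ′/2)w}·N·Σ_w)·(A·E·g·Σ₁)^k`,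
`N ≤ nI` (print: `N = |J_k| ≤ |I|`), fits the SECOND summand in both regimes, CLASS EDITION with the row `0 ≤ K₀ ≤ C_K0·b`** (rate `ϰ′/2`, `ϰ′ = ϰ/2 − (δ/2)D²√d ≥ 0`; wide corridors
`b₀ ≤ b → M·b^{3/2} ≤ w`; `ρ₃ + 1 ≤ (ϰ′/2)·M`): `≤ nI·(C·(k+1)!·(0! + b₀⁰e^{ρ₃b₀^{3/2}}))·e^{−ρ₃b^{3/2}}e^{ρ₄Ab^{ρ₃}}`, `C` closed and `s`-free.
[cite: BenfattoEtAl1978, (5.11) p.155, (5.35) p.159, Appendix D p.165, (4.7) p.152; Balaban1985BackgroundPropagators, Sect. E p.428 (class form; ours)] -/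
theorem cum_a_class_le (hA : 0 ≤ A) (hb : 1 ≤ b) (hL : ((L : ℕ) : ℝ) ≤ 2 * b ^ 2) (hδ : 0 ≤ δ) (hκ' : 0 ≤ κ / 2 - δ / 2 * ((D : ℝ) ^ 2 * Real.sqrt d))
    (hb₀ : 0 ≤ b₀) (hρ₃ : 0 ≤ ρ₃) (hρ₄ : 1 ≤ ρ₄) (hK₀ : 0 ≤ K₀) (hK₀b : K₀ ≤ CK0 * b) (hN0 : 0 ≤ N) (hNle : N ≤ nI)
    (hreg : b₀ ≤ b → M * b ^ (3 / 2 : ℝ) ≤ (w : ℝ)) (hM : ρ₃ + 1 ≤ (κ / 2 - δ / 2 * ((D : ℝ) ^ 2 * Real.sqrt d)) / 2 * M) (k : ℕ) :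
    (2 ^ (k + 1) * (2 ^ ((k + 1) * D) * 2 ^ 2 ^ ((k + 1) * D) * K₀ ^ ((k + 1) * D))) * ((A * Real.exp (δ / 2 * ((D : ℝ) ^ 2 * d)) * Real.exp (-((κ / 2 - δ / 2 * ((D : ℝ) ^ 2 * Real.sqrt d)) / 2 * w))) * N * ∑ p ∈ Finset.Icc 1 s, ((admissible p D).card : ℝ) * ((2 / (1 - Real.exp (-((κ / 2 - δ / 2 * ((D : ℝ) ^ 2 * Real.sqrt d)) / 2 / (p : ℕ) / Real.sqrt d))) * Real.exp ((κ / 2 - δ / 2 * ((D : ℝ) ^ 2 * Real.sqrt d)) / 2 / (p : ℕ) / Real.sqrt d)) ^ d) ^ (p - 1)) * (A * Real.exp (δ / 2 * ((D : ℝ) ^ 2 * d)) * ((1 : ℝ) * (2 / (1 - Real.exp (-(δ / (2 * ((k + 1 : ℕ) : ℝ)) / Real.sqrt d))) * Real.exp (δ / (2 * ((k + 1 : ℕ) : ℝ)) / Real.sqrt d)) ^ d) * ∑ p ∈ Finset.Icc 1 s, ((admissible p D).card : ℝ) * ((2 / (1 - Real.exp (-((κ / 2 - δ / 2 * ((D :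 ℝ) ^ 2 * Real.sqrt d)) / (p : ℕ) / Real.sqrt d))) * Real.exp ((κ / 2 - δ / 2 * ((D : ℝ) ^ 2 * Real.sqrt d)) / (p : ℕ) / Real.sqrt d)) ^ d) ^ (p - 1)) ^ k ≤
      nI * errTerm ((2 ^ (k + 1) * (2 ^ ((k + 1) * D) * 2 ^ 2 ^ ((k + 1) * D) * CK0 ^ ((k + 1) * D)) * (Real.exp (δ / 2 * ((D : ℝ) ^ 2 * d)) * ∑ p ∈ Finset.Icc 1 D, ((admissible p D).card : ℝ) * ((2 / (1 - Real.exp (-((κ / 2 - δ / 2 * ((D : ℝ) ^ 2 * Real.sqrt d)) / 2 / (p : ℕ) / Real.sqrt d))) * Real.exp ((κ / 2 - δ / 2 * ((D : ℝ) ^ 2 * Real.sqrt d)) / 2 / (p : ℕ) / Real.sqrt d)) ^ d) ^ (p - 1)) * (Real.exp (δ / 2 * ((D : ℝ) ^ 2 * d)) * ((1 : ℝ) * (2 / (1 - Real.exp (-(δ / (2 * ((k + 1 : ℕ) : ℝ)) / Real.sqrt d))) * Real.exp (δ / (2 * ((k + 1 : ℕ) : ℝ)) / Real.sqrt d)) ^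 d) * ∑ p ∈ Finset.Icc 1 D, ((admissible p D).card : ℝ) * ((2 / (1 - Real.exp (-((κ / 2 - δ / 2 * ((D : ℝ) ^ 2 * Real.sqrt d)) / (p : ℕ) / Real.sqrt d))) * Real.exp ((κ / 2 - δ / 2 * ((D : ℝ) ^ 2 * Real.sqrt d)) / (p : ℕ) / Real.sqrt d)) ^ d) ^ (p - 1)) ^ k) * (k + 1).factorial * ((0 + (k + 1) * D).factorial + b₀ ^ (0 + (k + 1) * D) * Real.exp (ρ₃ * b₀ ^ (3 / 2 : ℝ)))) ρ₁ ρ₂ ρ₃ ρ₄ A b t := by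
  have hb0 : 0 ≤ b := zero_le_one.trans hb
  have hCK0 : 0 ≤ CK0 := le_of_mul_le_mul_right (by simpa using hK₀.trans hK₀b) (by linarith : (0 : ℝ) < b)
  have hκ'2 : 0 ≤ (κ / 2 - δ / 2 * ((D : ℝ) ^ 2 * Real.sqrt d)) / 2 := by linarith
  obtain ⟨hSw0, hSwle⟩ := sum_adm_geom_nonneg_le hκ'2 s D d
  obtain ⟨hSwD0, -⟩ := sum_adm_geom_nonneg_le hκ'2 D D d
  obtain ⟨hS10, hS1le⟩ := sum_adm_geom_nonneg_le hκ' s D d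
  obtain ⟨hS1D0, -⟩ := sum_adm_geom_nonneg_le hκ' D D d
  set Sws := ∑ p ∈ Finset.Icc 1 s, ((admissible p D).card : ℝ) * ((2 / (1 - Real.exp (-((κ / 2 - δ / 2 * ((D : ℝ) ^ 2 * Real.sqrt d)) / 2 / (p : ℕ) / Real.sqrt d))) * Real.exp ((κ / 2 - δ / 2 * ((D : ℝ) ^ 2 * Real.sqrt d)) / 2 / (p : ℕ) / Real.sqrt d)) ^ d) ^ (p - 1) with hSws
  set SwD := ∑ p ∈ Finset.Icc 1 D, ((admissible p D).card : ℝ) * ((2 / (1 - Real.exp (-((κ / 2 - δ / 2 * ((D : ℝ) ^ 2 * Real.sqrt d)) / 2 / (p : ℕ) / Real.sqrt d))) * Real.exp ((κ / 2 - δ / 2 * ((D : ℝ) ^ 2 * Real.sqrt d)) / 2 / (p : ℕ) / Real.sqrt d)) ^ d) ^ (p - 1) with hSwD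
  clear_value Sws SwD
  set S1s := ∑ p ∈ Finset.Icc 1 s, ((admissible p D).card : ℝ) * ((2 / (1 - Real.exp (-((κ / 2 - δ / 2 * ((D : ℝ) ^ 2 * Real.sqrt d)) / (p : ℕ) / Real.sqrt d))) * Real.exp ((κ / 2 - δ / 2 * ((D : ℝ) ^ 2 * Real.sqrt d)) / (p : ℕ) / Real.sqrt d)) ^ d) ^ (p - 1) with hS1s
  set S1D := ∑ p ∈ Finset.Icc 1 D, ((admissible p D).card : ℝ) * ((2 / (1 - Real.exp (-((κ / 2 - δ / 2 * ((D : ℝ) ^ 2 * Real.sqrt d)) / (p : ℕ) / Real.sqrt d))) * Real.exp ((κ / 2 - δ / 2 * ((D : ℝ) ^ 2 * Real.sqrt d)) / (p : ℕ) / Real.sqrt d)) ^ d) ^ (p - 1) with hS1D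
  clear_value S1s S1D
  set ΦK : ℝ := 2 ^ ((k + 1) * D) * 2 ^ 2 ^ ((k + 1) * D) * K₀ ^ ((k + 1) * D) with hΦK
  set Φ : ℝ := 2 ^ ((k + 1) * D) * 2 ^ 2 ^ ((k + 1) * D) * CK0 ^ ((k + 1) * D) with hΦ
  have hΦK0 : 0 ≤ ΦK := by rw [hΦK]; positivity
  have hΦ0 : 0 ≤ Φ := by rw [hΦ]; positivity
  have hΦle : ΦK ≤ Φ * b ^ ((k + 1) * D) := by
    rw [hΦK, hΦ, mul_assoc (2 ^ ((k + 1) * D) * 2 ^ 2 ^ ((k + 1) * D)) (CK0 ^ ((k + 1) * D)), ← mul_pow]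
    exact mul_le_mul_of_nonneg_left (pow_le_pow_left₀ hK₀ hK₀b _) (by positivity)
  clear_value ΦK Φ
  set E : ℝ := Real.exp (δ / 2 * ((D : ℝ) ^ 2 * d)) with hE
  have hE0 : 0 ≤ E := by rw [hE]; exact (Real.exp_pos _).le
  clear_value E
  set g : ℝ := (2 / (1 - Real.exp (-(δ / (2 * ((k + 1 : ℕ) : ℝ)) / Real.sqrt d))) * Real.exp (δ / (2 * ((k + 1 : ℕ) : ℝ)) / Real.sqrt d)) ^ d with hg
  have hg0 : 0 ≤ g := by rw [hg]; exact pow_nonneg (geom_nonneg' (by positivity)) d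
  clear_value g
  have hLd := side_pow_le hL d
  have hLd0 : 0 ≤ ((L : ℕ) : ℝ) ^ d := by positivity
  have hc0 : 0 ≤ (κ / 2 - δ / 2 * ((D : ℝ) ^ 2 * Real.sqrt d)) / 2 := hκ'2
  have hX0 : (0 : ℝ) ≤ (w : ℝ) := Nat.cast_nonneg w
  have h1 : (A * E * ((1 : ℝ) * g) * S1s) ^ k ≤ (A * E * ((1 : ℝ) * g) * S1D) ^ k := pow_le_pow_left₀ (by positivity) (by gcongr) k
  have hnI' : 0 ≤ nI := hN0.trans hNle
  have hkey : (2 ^ (k + 1) * (ΦK)) * ((A * E * Real.exp (-((κ / 2 - δ / 2 * ((D : ℝ) ^ 2 * Real.sqrt d)) / 2 * w))) * N * Sws) * (A * E * ((1 : ℝ) * g) * S1s) ^ k ≤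
      ((2 ^ (k + 1) * (Φ) * (E * SwD) * (E * ((1 : ℝ) * g) * S1D) ^ k) * b ^ (0 + (k + 1) * D) * A ^ (k + 1) * Real.exp (-((κ / 2 - δ / 2 * ((D : ℝ) ^ 2 * Real.sqrt d)) / 2 * ((w : ℝ))))) * N := by
    calc (2 ^ (k + 1) * (ΦK)) * ((A * E * Real.exp (-((κ / 2 - δ / 2 * ((D : ℝ) ^ 2 * Real.sqrt d)) / 2 * w))) * N * Sws) * (A * E * ((1 : ℝ) * g) * S1s) ^ k
        ≤ (2 ^ (k + 1) * (Φ * b ^ ((k + 1) * D))) * ((A * E * Real.exp (-((κ / 2 - δ / 2 * ((D : ℝ) ^ 2 * Real.sqrt d)) / 2 * w))) * N * SwD) * (A * E * ((1 : ℝ) * g) * S1D) ^ k := by gcongr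
      _ = _ := by ring
  have hatom := decay_atom_le_snd (A := A) (b := b) (b₀ := b₀) (ρ₃ := ρ₃) (ρ₄ := ρ₄)
    (C := 2 ^ (k + 1) * (Φ) * (E * SwD) * (E * ((1 : ℝ) * g) * S1D) ^ k) (c := (κ / 2 - δ / 2 * ((D : ℝ) ^ 2 * Real.sqrt d)) / 2) (X := (w : ℝ)) (M := M)
    (by positivity) hA hb hb₀ hρ₃ hρ₄ hc0 hX0 hreg hM (0 + (k + 1) * D) (k + 1)
  have hS0' : 0 ≤ (2 ^ (k + 1) * (Φ) * (E * SwD) * (E * ((1 : ℝ) * g) * S1D) ^ k) * (k + 1).factorial * ((0 + (k + 1) * D).factorial + b₀ ^ (0 + (k + 1) * D) * Real.exp (ρ₃ * b₀ ^ (3 / 2 : ℝ))) := by positivity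
  have hS0 : 0 ≤ (2 ^ (k + 1) * (Φ) * (E * SwD) * (E * ((1 : ℝ) * g) * S1D) ^ k) * (k + 1).factorial * ((0 + (k + 1) * D).factorial + b₀ ^ (0 + (k + 1) * D) * Real.exp (ρ₃ * b₀ ^ (3 / 2 : ℝ))) * (Real.exp (-(ρ₃ * b ^ (3 / 2 : ℝ))) * Real.exp (ρ₄ * A * b ^ ρ₃)) := by positivity
  have hfin := le_errTerm_of_le_snd (ρ₁ := ρ₁) (ρ₂ := ρ₂) (t := t) (le_refl ((2 ^ (k + 1) * (Φ) * (E * SwD) * (E * ((1 : ℝ) * g) * S1D) ^ k) * (k + 1).factorial * ((0 + (k + 1) * D).factorial + b₀ ^ (0 + (k + 1) * D) * Real.exp (ρ₃ * b₀ ^ (3 / 2 : ℝ))) * (Real.exp (-(ρ₃ * b ^ (3 / 2 : ℝ))) * Real.exp (ρ₄ * A * b ^ ρ₃)))) hS0' hA hb0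
  calc (2 ^ (k + 1) * (ΦK)) * ((A * E * Real.exp (-((κ / 2 - δ / 2 * ((D : ℝ) ^ 2 * Real.sqrt d)) / 2 * w))) * N * Sws) * (A * E * ((1 : ℝ) * g) * S1s) ^ k
      ≤ ((2 ^ (k + 1) * (Φ) * (E * SwD) * (E * ((1 : ℝ) * g) * S1D) ^ k) * b ^ (0 + (k + 1) * D) * A ^ (k + 1) * Real.exp (-((κ / 2 - δ / 2 * ((D : ℝ) ^ 2 * Real.sqrt d)) / 2 * ((w : ℝ))))) * N := hkey
    _ ≤ ((2 ^ (k + 1) * (Φ) * (E * SwD) * (E * ((1 : ℝ) * g) * S1D) ^ k) * (k + 1).factorial * ((0 + (k + 1) * D).factorial + b₀ ^ (0 + (k + 1) * D) * Real.exp (ρ₃ * b₀ ^ (3 / 2 : ℝ))) * (Real.exp (-(ρ₃ * b ^ (3 / 2 : ℝ))) * Real.exp (ρ₄ * A * b ^ ρ₃))) * nI := mul_le_mul hatom hNle hN0 hS0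
    _ = nI * ((2 ^ (k + 1) * (Φ) * (E * SwD) * (E * ((1 : ℝ) * g) * S1D) ^ k) * (k + 1).factorial * ((0 + (k + 1) * D).factorial + b₀ ^ (0 + (k + 1) * D) * Real.exp (ρ₃ * b₀ ^ (3 / 2 : ℝ))) * (Real.exp (-(ρ₃ * b ^ (3 / 2 : ℝ))) * Real.exp (ρ₄ * A * b ^ ρ₃))) := by ring
    _ ≤ _ := mul_le_mul_of_nonneg_left hfin hnI'


set_option maxHeartbeats 400000 in -- long `calc`/closed-term elaboration (ops-buildfix 2026-08-27: keep ≥ 2× headroom)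
/-- **ATOM (b) = (d) — the (5.34)-type term `2^{k+1}Φ·(N·A·E·e^{−(ϰ′/2)v}·L^d·Σ_w)·(A·E·g·Σ₁)^k` (print: `N = |B_k| ≤ |I|`) fits the SECOND summand in
both regimes, CLASS EDITION with the row `0 ≤ K₀ ≤ C_K0·b`** (rate `ϰ′/2`, `X = v`): `≤ nI·(C·(k+1)!·((2d)! + b₀^{2d}e^{ρ₃b₀^{3/2}}))·e^{−ρ₃b^{3/2}}e^{ρ₄Ab^{ρ₃}}`.
[cite: BenfattoEtAl1978, (5.34) p.159, (5.35) p.159, Appendix D p.165, (4.7) p.152; Balaban1985BackgroundPropagators, Sect. E p.428 (class form; ours)] -/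
theorem cum_b_class_le (hA : 0 ≤ A) (hb : 1 ≤ b) (hL : ((L : ℕ) : ℝ) ≤ 2 * b ^ 2) (hδ : 0 ≤ δ) (hκ' : 0 ≤ κ / 2 - δ / 2 * ((D : ℝ) ^ 2 * Real.sqrt d))
    (hb₀ : 0 ≤ b₀) (hρ₃ : 0 ≤ ρ₃) (hρ₄ : 1 ≤ ρ₄) (hK₀ : 0 ≤ K₀) (hK₀b : K₀ ≤ CK0 * b) (hN0 : 0 ≤ N) (hNle : N ≤ nI)
    (hreg : b₀ ≤ b → M * b ^ (3 / 2 : ℝ) ≤ (v : ℝ)) (hM : ρ₃ + 1 ≤ (κ / 2 - δ / 2 * ((D : ℝ) ^ 2 * Real.sqrt d)) / 2 * M) (k : ℕ) :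
    2 ^ (k + 1) * (2 ^ ((k + 1) * D) * 2 ^ 2 ^ ((k + 1) * D) * K₀ ^ ((k + 1) * D)) * (N * (A * Real.exp (δ / 2 * ((D : ℝ) ^ 2 * d)) * Real.exp (-((κ / 2 - δ / 2 * ((D : ℝ) ^ 2 * Real.sqrt d)) / 2 * v))) * ((L : ℕ) : ℝ) ^ d * ∑ p ∈ Finset.Icc 1 s, ((admissible p D).card : ℝ) * ((2 / (1 - Real.exp (-((κ / 2 - δ / 2 * ((D : ℝ) ^ 2 * Real.sqrt d)) / 2 / (p : ℕ) / Real.sqrt d))) * Real.exp ((κ / 2 - δ / 2 * ((D : ℝ) ^ 2 * Real.sqrt d)) / 2 / (p : ℕ) / Real.sqrt d)) ^ d) ^ (p - 1)) * (A * Real.exp (δ / 2 * ((D : ℝ) ^ 2 * d)) * (2 / (1 - Real.exp (-(δ / (2 * ((k + 1 : ℕ) : ℝ)) / Real.sqrt d))) * Real.exp (δ / (2 * ((k + 1 : ℕ) : ℝ)) / Real.sqrt d)) ^ d * ∑ p ∈ Finset.Icc 1 s, ((admissible p D).card : ℝ) * ((2 / (1 - Real.exp (-((κ / 2 - δ / 2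 * ((D : ℝ) ^ 2 * Real.sqrt d)) / (p : ℕ) / Real.sqrt d))) * Real.exp ((κ / 2 - δ / 2 * ((D : ℝ) ^ 2 * Real.sqrt d)) / (p : ℕ) / Real.sqrt d)) ^ d) ^ (p - 1)) ^ k ≤
      nI * errTerm ((2 ^ (k + 1) * (2 ^ ((k + 1) * D) * 2 ^ 2 ^ ((k + 1) * D) * CK0 ^ ((k + 1) * D)) * (Real.exp (δ / 2 * ((D : ℝ) ^ 2 * d)) * 2 ^ d * ∑ p ∈ Finset.Icc 1 D, ((admissible p D).card : ℝ) * ((2 / (1 - Real.exp (-((κ / 2 - δ / 2 * ((D : ℝ) ^ 2 * Real.sqrt d)) / 2 / (p : ℕ) / Real.sqrt d))) * Real.exp ((κ / 2 - δ / 2 * ((D : ℝ) ^ 2 * Real.sqrt d)) / 2 / (p : ℕ) / Real.sqrt d)) ^ d) ^ (p - 1)) * (Real.exp (δ / 2 * ((D : ℝ) ^ 2 * d)) * (2 / (1 - Real.exp (-(δ / (2 * ((k + 1 : ℕ) : ℝ)) / Real.sqrt d))) * Real.exp (δ / (2 * ((k + 1 : ℕ) : ℝ)) / Real.sqrt d))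 ^ d * ∑ p ∈ Finset.Icc 1 D, ((admissible p D).card : ℝ) * ((2 / (1 - Real.exp (-((κ / 2 - δ / 2 * ((D : ℝ) ^ 2 * Real.sqrt d)) / (p : ℕ) / Real.sqrt d))) * Real.exp ((κ / 2 - δ / 2 * ((D : ℝ) ^ 2 * Real.sqrt d)) / (p : ℕ) / Real.sqrt d)) ^ d) ^ (p - 1)) ^ k) * (k + 1).factorial * ((2 * d + (k + 1) * D).factorial + b₀ ^ (2 * d + (k + 1) * D) * Real.exp (ρ₃ * b₀ ^ (3 / 2 : ℝ)))) ρ₁ ρ₂ ρ₃ ρ₄ A b t := by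
  have hb0 : 0 ≤ b := zero_le_one.trans hb
  have hCK0 : 0 ≤ CK0 := le_of_mul_le_mul_right (by simpa using hK₀.trans hK₀b) (by linarith : (0 : ℝ) < b)
  have hκ'2 : 0 ≤ (κ / 2 - δ / 2 * ((D : ℝ) ^ 2 * Real.sqrt d)) / 2 := by linarith
  obtain ⟨hSw0, hSwle⟩ := sum_adm_geom_nonneg_le hκ'2 s D d
  obtain ⟨hSwD0, -⟩ := sum_adm_geom_nonneg_le hκ'2 D D d
  obtain ⟨hS10, hS1le⟩ := sum_adm_geom_nonneg_le hκ' s D d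
  obtain ⟨hS1D0, -⟩ := sum_adm_geom_nonneg_le hκ' D D d
  set Sws := ∑ p ∈ Finset.Icc 1 s, ((admissible p D).card : ℝ) * ((2 / (1 - Real.exp (-((κ / 2 - δ / 2 * ((D : ℝ) ^ 2 * Real.sqrt d)) / 2 / (p : ℕ) / Real.sqrt d))) * Real.exp ((κ / 2 - δ / 2 * ((D : ℝ) ^ 2 * Real.sqrt d)) / 2 / (p : ℕ) / Real.sqrt d)) ^ d) ^ (p - 1) with hSws
  set SwD := ∑ p ∈ Finset.Icc 1 D, ((admissible p D).card : ℝ) * ((2 / (1 - Real.exp (-((κ / 2 - δ / 2 * ((D : ℝ) ^ 2 * Real.sqrt d)) / 2 / (p : ℕ) / Real.sqrt d))) * Real.exp ((κ / 2 - δ / 2 * ((D : ℝ) ^ 2 * Real.sqrt d)) / 2 / (p : ℕ) / Real.sqrt d)) ^ d) ^ (p - 1) with hSwD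
  clear_value Sws SwD
  set S1s := ∑ p ∈ Finset.Icc 1 s, ((admissible p D).card : ℝ) * ((2 / (1 - Real.exp (-((κ / 2 - δ / 2 * ((D : ℝ) ^ 2 * Real.sqrt d)) / (p : ℕ) / Real.sqrt d))) * Real.exp ((κ / 2 - δ / 2 * ((D : ℝ) ^ 2 * Real.sqrt d)) / (p : ℕ) / Real.sqrt d)) ^ d) ^ (p - 1) with hS1s
  set S1D := ∑ p ∈ Finset.Icc 1 D, ((admissible p D).card : ℝ) * ((2 / (1 - Real.exp (-((κ / 2 - δ / 2 * ((D : ℝ) ^ 2 * Real.sqrt d)) / (p : ℕ) / Real.sqrt d))) * Real.exp ((κ / 2 - δ / 2 * ((D : ℝ) ^ 2 * Real.sqrt d)) / (p : ℕ) / Real.sqrt d)) ^ d) ^ (p - 1) with hS1D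
  clear_value S1s S1D
  set ΦK : ℝ := 2 ^ ((k + 1) * D) * 2 ^ 2 ^ ((k + 1) * D) * K₀ ^ ((k + 1) * D) with hΦK
  set Φ : ℝ := 2 ^ ((k + 1) * D) * 2 ^ 2 ^ ((k + 1) * D) * CK0 ^ ((k + 1) * D) with hΦ
  have hΦK0 : 0 ≤ ΦK := by rw [hΦK]; positivity
  have hΦ0 : 0 ≤ Φ := by rw [hΦ]; positivity
  have hΦle : ΦK ≤ Φ * b ^ ((k + 1) * D) := by
    rw [hΦK, hΦ, mul_assoc (2 ^ ((k + 1) * D) * 2 ^ 2 ^ ((k + 1) * D)) (CK0 ^ ((k + 1) * D)), ← mul_pow]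
    exact mul_le_mul_of_nonneg_left (pow_le_pow_left₀ hK₀ hK₀b _) (by positivity)
  clear_value ΦK Φ
  set E : ℝ := Real.exp (δ / 2 * ((D : ℝ) ^ 2 * d)) with hE
  have hE0 : 0 ≤ E := by rw [hE]; exact (Real.exp_pos _).le
  clear_value E
  set g : ℝ := (2 / (1 - Real.exp (-(δ / (2 * ((k + 1 : ℕ) : ℝ)) / Real.sqrt d))) * Real.exp (δ / (2 * ((k + 1 : ℕ) : ℝ)) / Real.sqrt d)) ^ d with hg
  have hg0 : 0 ≤ g := by rw [hg]; exact pow_nonneg (geom_nonneg' (by positivity)) d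
  clear_value g
  have hLd := side_pow_le hL d
  have hLd0 : 0 ≤ ((L : ℕ) : ℝ) ^ d := by positivity
  have hc0 : 0 ≤ (κ / 2 - δ / 2 * ((D : ℝ) ^ 2 * Real.sqrt d)) / 2 := hκ'2
  have hX0 : (0 : ℝ) ≤ (v : ℝ) := Nat.cast_nonneg v
  have h1 : (A * E * g * S1s) ^ k ≤ (A * E * g * S1D) ^ k := pow_le_pow_left₀ (by positivity) (by gcongr) k
  have hnI' : 0 ≤ nI := hN0.trans hNle
  have hkey : 2 ^ (k + 1) * (ΦK) * (N * (A * E * Real.exp (-((κ / 2 - δ / 2 * ((D : ℝ) ^ 2 * Real.sqrt d)) / 2 * v))) * ((L : ℕ) : ℝ) ^ d * Sws) * (A * E * g * S1s) ^ k ≤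
      ((2 ^ (k + 1) * (Φ) * (E * 2 ^ d * SwD) * (E * g * S1D) ^ k) * b ^ (2 * d + (k + 1) * D) * A ^ (k + 1) * Real.exp (-((κ / 2 - δ / 2 * ((D : ℝ) ^ 2 * Real.sqrt d)) / 2 * ((v : ℝ))))) * N := by
    calc 2 ^ (k + 1) * (ΦK) * (N * (A * E * Real.exp (-((κ / 2 - δ / 2 * ((D : ℝ) ^ 2 * Real.sqrt d)) / 2 * v))) * ((L : ℕ) : ℝ) ^ d * Sws) * (A * E * g * S1s) ^ k
        ≤ 2 ^ (k + 1) * (Φ * b ^ ((k + 1) * D)) * (N * (A * E * Real.exp (-((κ / 2 - δ / 2 * ((D : ℝ) ^ 2 * Real.sqrt d)) / 2 * v))) * (2 ^ d * b ^ (2 * d)) * SwD) * (A * E * g * S1D) ^ k := by gcongr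
      _ = _ := by ring
  have hatom := decay_atom_le_snd (A := A) (b := b) (b₀ := b₀) (ρ₃ := ρ₃) (ρ₄ := ρ₄)
    (C := 2 ^ (k + 1) * (Φ) * (E * 2 ^ d * SwD) * (E * g * S1D) ^ k) (c := (κ / 2 - δ / 2 * ((D : ℝ) ^ 2 * Real.sqrt d)) / 2) (X := (v : ℝ)) (M := M)
    (by positivity) hA hb hb₀ hρ₃ hρ₄ hc0 hX0 hreg hM (2 * d + (k + 1) * D) (k + 1)
  have hS0' : 0 ≤ (2 ^ (k + 1) * (Φ) * (E * 2 ^ d * SwD) * (E * g * S1D) ^ k) * (k + 1).factorial * ((2 * d + (k + 1) * D).factorial + b₀ ^ (2 * d + (k + 1) * D) * Real.exp (ρ₃ * b₀ ^ (3 / 2 : ℝ))) := by positivity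
  have hS0 : 0 ≤ (2 ^ (k + 1) * (Φ) * (E * 2 ^ d * SwD) * (E * g * S1D) ^ k) * (k + 1).factorial * ((2 * d + (k + 1) * D).factorial + b₀ ^ (2 * d + (k + 1) * D) * Real.exp (ρ₃ * b₀ ^ (3 / 2 : ℝ))) * (Real.exp (-(ρ₃ * b ^ (3 / 2 : ℝ))) * Real.exp (ρ₄ * A * b ^ ρ₃)) := by positivity
  have hfin := le_errTerm_of_le_snd (ρ₁ := ρ₁) (ρ₂ := ρ₂) (t := t) (le_refl ((2 ^ (k + 1) * (Φ) * (E * 2 ^ d * SwD) * (E * g * S1D) ^ k) * (k + 1).factorial * ((2 * d + (k + 1) * D).factorial + b₀ ^ (2 * d + (k + 1) * D) * Real.exp (ρ₃ * b₀ ^ (3 / 2 : ℝ))) * (Real.exp (-(ρ₃ * b ^ (3 / 2 : ℝ))) * Real.exp (ρ₄ * A * b ^ ρ₃)))) hS0' hA hb0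
  calc 2 ^ (k + 1) * (ΦK) * (N * (A * E * Real.exp (-((κ / 2 - δ / 2 * ((D : ℝ) ^ 2 * Real.sqrt d)) / 2 * v))) * ((L : ℕ) : ℝ) ^ d * Sws) * (A * E * g * S1s) ^ k
      ≤ ((2 ^ (k + 1) * (Φ) * (E * 2 ^ d * SwD) * (E * g * S1D) ^ k) * b ^ (2 * d + (k + 1) * D) * A ^ (k + 1) * Real.exp (-((κ / 2 - δ / 2 * ((D : ℝ) ^ 2 * Real.sqrt d)) / 2 * ((v : ℝ))))) * N := hkey
    _ ≤ ((2 ^ (k + 1) * (Φ) * (E * 2 ^ d * SwD) * (E * g * S1D) ^ k) * (k + 1).factorial * ((2 * d + (k + 1) * D).factorial + b₀ ^ (2 * d + (k + 1) * D) * Real.exp (ρ₃ * b₀ ^ (3 / 2 : ℝ))) * (Real.exp (-(ρ₃ * b ^ (3 / 2 : ℝ))) * Real.exp (ρ₄ * A * b ^ ρ₃))) * nI := mul_le_mul hatom hNle hN0 hS0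
    _ = nI * ((2 ^ (k + 1) * (Φ) * (E * 2 ^ d * SwD) * (E * g * S1D) ^ k) * (k + 1).factorial * ((2 * d + (k + 1) * D).factorial + b₀ ^ (2 * d + (k + 1) * D) * Real.exp (ρ₃ * b₀ ^ (3 / 2 : ℝ))) * (Real.exp (-(ρ₃ * b ^ (3 / 2 : ℝ))) * Real.exp (ρ₄ * A * b ^ ρ₃))) := by ring
    _ ≤ _ := mul_le_mul_of_nonneg_left hfin hnI'


set_option maxHeartbeats 400000 in -- long `calc`/closed-term elaboration (ops-buildfix 2026-08-27: keep ≥ 2× headroom)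
/-- **ATOM (c) — the `|Ê₀^T(H_{Γ̄₁}) − Ê₀^T(Y)|` term `2^{k+1}Φ·(A·E·e^{−(ϰ′/2)w}·N·Σ_w)·(A·E·g·Σ₁)^k` with `N ≤ nI·L^d` (print: `N = |Γ̄₁(B_k)| ≤
|B_k|·L^d`) fits the SECOND summand in both regimes, CLASS EDITION with the row `0 ≤ K₀ ≤ C_K0·b`** (rate `ϰ′/2`, `X = w`): `≤ nI·(C·(k+1)!·((2d)! + b₀^{2d}e^{ρ₃b₀^{3/2}}))·e^{−ρ₃b^{3/2}}e^{ρ₄Ab^{ρ₃}}`.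
[cite: BenfattoEtAl1978, (5.11) p.155, (5.35) p.159, Appendix D p.165, (4.7) p.152; Balaban1985BackgroundPropagators, Sect. E p.428 (class form; ours)] -/
theorem cum_c_class_le (hA : 0 ≤ A) (hb : 1 ≤ b) (hL : ((L : ℕ) : ℝ) ≤ 2 * b ^ 2) (hδ : 0 ≤ δ) (hκ' : 0 ≤ κ / 2 - δ / 2 * ((D : ℝ) ^ 2 * Real.sqrt d))
    (hb₀ : 0 ≤ b₀) (hρ₃ : 0 ≤ ρ₃) (hρ₄ : 1 ≤ ρ₄) (hK₀ : 0 ≤ K₀) (hK₀b : K₀ ≤ CK0 * b) (hnI : 0 ≤ nI) (hN0 : 0 ≤ N) (hNle : N ≤ nI * ((L : ℕ) : ℝ) ^ d)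
    (hreg : b₀ ≤ b → M * b ^ (3 / 2 : ℝ) ≤ (w : ℝ)) (hM : ρ₃ + 1 ≤ (κ / 2 - δ / 2 * ((D : ℝ) ^ 2 * Real.sqrt d)) / 2 * M) (k : ℕ) :
    (2 ^ (k + 1) * (2 ^ ((k + 1) * D) * 2 ^ 2 ^ ((k + 1) * D) * K₀ ^ ((k + 1) * D))) * (A * Real.exp (δ / 2 * ((D : ℝ) ^ 2 * d)) * Real.exp (-((κ / 2 - δ / 2 * ((D : ℝ) ^ 2 * Real.sqrt d)) / 2 * w)) * N * ∑ p ∈ Finset.Icc 1 s, ((admissible p D).card : ℝ) * ((2 / (1 - Real.exp (-((κ / 2 - δ / 2 * ((D : ℝ) ^ 2 * Real.sqrt d)) / 2 / (p : ℕ) / Real.sqrt d))) * Real.exp ((κ / 2 - δ / 2 * ((D : ℝ) ^ 2 * Real.sqrt d)) / 2 / (p : ℕ) / Real.sqrt d)) ^ d) ^ (p - 1)) * (A * Real.exp (δ / 2 * ((D : ℝ) ^ 2 * d)) * (2 / (1 - Real.exp (-(δ / (2 * ((k + 1 : ℕ) : ℝ)) / Real.sqrt d))) * Real.exp (δ / (2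 * ((k + 1 : ℕ) : ℝ)) / Real.sqrt d)) ^ d * ∑ p ∈ Finset.Icc 1 s, ((admissible p D).card : ℝ) * ((2 / (1 - Real.exp (-((κ / 2 - δ / 2 * ((D : ℝ) ^ 2 * Real.sqrt d)) / (p : ℕ) / Real.sqrt d))) * Real.exp ((κ / 2 - δ / 2 * ((D : ℝ) ^ 2 * Real.sqrt d)) / (p : ℕ) / Real.sqrt d)) ^ d) ^ (p - 1)) ^ k ≤
      nI * errTerm ((2 ^ (k + 1) * (2 ^ ((k + 1) * D) * 2 ^ 2 ^ ((k + 1) * D) * CK0 ^ ((k + 1) * D)) * (Real.exp (δ / 2 * ((D : ℝ) ^ 2 * d)) * 2 ^ d * ∑ p ∈ Finset.Icc 1 D, ((admissible p D).card : ℝ) * ((2 / (1 - Real.exp (-((κ / 2 - δ / 2 * ((D : ℝ) ^ 2 * Real.sqrt d)) / 2 / (p : ℕ) / Real.sqrt d))) * Real.exp ((κ / 2 - δ / 2 * ((D : ℝ) ^ 2 * Real.sqrt d)) / 2 / (p : ℕ) / Real.sqrt d)) ^ d) ^ (p - 1)) * (Real.exp (δ / 2 * ((D : ℝ) ^ 2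 * d)) * (2 / (1 - Real.exp (-(δ / (2 * ((k + 1 : ℕ) : ℝ)) / Real.sqrt d))) * Real.exp (δ / (2 * ((k + 1 : ℕ) : ℝ)) / Real.sqrt d)) ^ d * ∑ p ∈ Finset.Icc 1 D, ((admissible p D).card : ℝ) * ((2 / (1 - Real.exp (-((κ / 2 - δ / 2 * ((D : ℝ) ^ 2 * Real.sqrt d)) / (p : ℕ) / Real.sqrt d))) * Real.exp ((κ / 2 - δ / 2 * ((D : ℝ) ^ 2 * Real.sqrt d)) / (p : ℕ) / Real.sqrt d)) ^ d) ^ (p - 1)) ^ k) * (k + 1).factorial * ((2 * d + (k + 1) * D).factorial + b₀ ^ (2 * d + (k + 1) * D) * Real.exp (ρ₃ * b₀ ^ (3 / 2 : ℝ)))) ρ₁ ρ₂ ρ₃ ρ₄ A b t := by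
  have hb0 : 0 ≤ b := zero_le_one.trans hb
  have hCK0 : 0 ≤ CK0 := le_of_mul_le_mul_right (by simpa using hK₀.trans hK₀b) (by linarith : (0 : ℝ) < b)
  have hκ'2 : 0 ≤ (κ / 2 - δ / 2 * ((D : ℝ) ^ 2 * Real.sqrt d)) / 2 := by linarith
  obtain ⟨hSw0, hSwle⟩ := sum_adm_geom_nonneg_le hκ'2 s D d
  obtain ⟨hSwD0, -⟩ := sum_adm_geom_nonneg_le hκ'2 D D d
  obtain ⟨hS10, hS1le⟩ := sum_adm_geom_nonneg_le hκ' s D d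
  obtain ⟨hS1D0, -⟩ := sum_adm_geom_nonneg_le hκ' D D d
  set Sws := ∑ p ∈ Finset.Icc 1 s, ((admissible p D).card : ℝ) * ((2 / (1 - Real.exp (-((κ / 2 - δ / 2 * ((D : ℝ) ^ 2 * Real.sqrt d)) / 2 / (p : ℕ) / Real.sqrt d))) * Real.exp ((κ / 2 - δ / 2 * ((D : ℝ) ^ 2 * Real.sqrt d)) / 2 / (p : ℕ) / Real.sqrt d)) ^ d) ^ (p - 1) with hSws
  set SwD := ∑ p ∈ Finset.Icc 1 D, ((admissible p D).card : ℝ) * ((2 / (1 - Real.exp (-((κ / 2 - δ / 2 * ((D : ℝ) ^ 2 * Real.sqrt d)) / 2 / (p : ℕ) / Real.sqrt d))) * Real.exp ((κ / 2 - δ / 2 * ((D : ℝ) ^ 2 * Real.sqrt d)) / 2 / (p : ℕ) / Real.sqrt d)) ^ d) ^ (p - 1) with hSwD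
  clear_value Sws SwD
  set S1s := ∑ p ∈ Finset.Icc 1 s, ((admissible p D).card : ℝ) * ((2 / (1 - Real.exp (-((κ / 2 - δ / 2 * ((D : ℝ) ^ 2 * Real.sqrt d)) / (p : ℕ) / Real.sqrt d))) * Real.exp ((κ / 2 - δ / 2 * ((D : ℝ) ^ 2 * Real.sqrt d)) / (p : ℕ) / Real.sqrt d)) ^ d) ^ (p - 1) with hS1s
  set S1D := ∑ p ∈ Finset.Icc 1 D, ((admissible p D).card : ℝ) * ((2 / (1 - Real.exp (-((κ / 2 - δ / 2 * ((D : ℝ) ^ 2 * Real.sqrt d)) / (p : ℕ) / Real.sqrt d))) * Real.exp ((κ / 2 - δ / 2 * ((D : ℝ) ^ 2 * Real.sqrt d)) / (p : ℕ) / Real.sqrt d)) ^ d) ^ (p - 1) with hS1D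
  clear_value S1s S1D
  set ΦK : ℝ := 2 ^ ((k + 1) * D) * 2 ^ 2 ^ ((k + 1) * D) * K₀ ^ ((k + 1) * D) with hΦK
  set Φ : ℝ := 2 ^ ((k + 1) * D) * 2 ^ 2 ^ ((k + 1) * D) * CK0 ^ ((k + 1) * D) with hΦ
  have hΦK0 : 0 ≤ ΦK := by rw [hΦK]; positivity
  have hΦ0 : 0 ≤ Φ := by rw [hΦ]; positivity
  have hΦle : ΦK ≤ Φ * b ^ ((k + 1) * D) := by
    rw [hΦK, hΦ, mul_assoc (2 ^ ((k + 1) * D) * 2 ^ 2 ^ ((k + 1) * D)) (CK0 ^ ((k + 1) * D)), ← mul_pow]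
    exact mul_le_mul_of_nonneg_left (pow_le_pow_left₀ hK₀ hK₀b _) (by positivity)
  clear_value ΦK Φ
  set E : ℝ := Real.exp (δ / 2 * ((D : ℝ) ^ 2 * d)) with hE
  have hE0 : 0 ≤ E := by rw [hE]; exact (Real.exp_pos _).le
  clear_value E
  set g : ℝ := (2 / (1 - Real.exp (-(δ / (2 * ((k + 1 : ℕ) : ℝ)) / Real.sqrt d))) * Real.exp (δ / (2 * ((k + 1 : ℕ) : ℝ)) / Real.sqrt d)) ^ d with hg
  have hg0 : 0 ≤ g := by rw [hg]; exact pow_nonneg (geom_nonneg' (by positivity)) d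
  clear_value g
  have hLd := side_pow_le hL d
  have hLd0 : 0 ≤ ((L : ℕ) : ℝ) ^ d := by positivity
  have hc0 : 0 ≤ (κ / 2 - δ / 2 * ((D : ℝ) ^ 2 * Real.sqrt d)) / 2 := hκ'2
  have hX0 : (0 : ℝ) ≤ (w : ℝ) := Nat.cast_nonneg w
  have h1 : (A * E * g * S1s) ^ k ≤ (A * E * g * S1D) ^ k := pow_le_pow_left₀ (by positivity) (by gcongr) k
  have hNle' : N ≤ nI * (2 ^ d * b ^ (2 * d)) := hNle.trans (mul_le_mul_of_nonneg_left hLd hnI)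
  have hnI' : 0 ≤ nI := hnI
  have hkey : (2 ^ (k + 1) * (ΦK)) * (A * E * Real.exp (-((κ / 2 - δ / 2 * ((D : ℝ) ^ 2 * Real.sqrt d)) / 2 * w)) * N * Sws) * (A * E * g * S1s) ^ k ≤
      ((2 ^ (k + 1) * (Φ) * (E * 2 ^ d * SwD) * (E * g * S1D) ^ k) * b ^ (2 * d + (k + 1) * D) * A ^ (k + 1) * Real.exp (-((κ / 2 - δ / 2 * ((D : ℝ) ^ 2 * Real.sqrt d)) / 2 * ((w : ℝ))))) * nI := by
    calc (2 ^ (k + 1) * (ΦK)) * (A * E * Real.exp (-((κ / 2 - δ / 2 * ((D : ℝ) ^ 2 * Real.sqrt d)) / 2 * w)) * N * Sws) * (A * E * g * S1s) ^ k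
        ≤ (2 ^ (k + 1) * (Φ * b ^ ((k + 1) * D))) * (A * E * Real.exp (-((κ / 2 - δ / 2 * ((D : ℝ) ^ 2 * Real.sqrt d)) / 2 * w)) * (nI * (2 ^ d * b ^ (2 * d))) * SwD) * (A * E * g * S1D) ^ k := by gcongr
      _ = _ := by ring
  have hatom := decay_atom_le_snd (A := A) (b := b) (b₀ := b₀) (ρ₃ := ρ₃) (ρ₄ := ρ₄)
    (C := 2 ^ (k + 1) * (Φ) * (E * 2 ^ d * SwD) * (E * g * S1D) ^ k) (c := (κ / 2 - δ / 2 * ((D : ℝ) ^ 2 * Real.sqrt d)) / 2) (X := (w : ℝ)) (M := M)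
    (by positivity) hA hb hb₀ hρ₃ hρ₄ hc0 hX0 hreg hM (2 * d + (k + 1) * D) (k + 1)
  have hS0' : 0 ≤ (2 ^ (k + 1) * (Φ) * (E * 2 ^ d * SwD) * (E * g * S1D) ^ k) * (k + 1).factorial * ((2 * d + (k + 1) * D).factorial + b₀ ^ (2 * d + (k + 1) * D) * Real.exp (ρ₃ * b₀ ^ (3 / 2 : ℝ))) := by positivity
  have hS0 : 0 ≤ (2 ^ (k + 1) * (Φ) * (E * 2 ^ d * SwD) * (E * g * S1D) ^ k) * (k + 1).factorial * ((2 * d + (k + 1) * D).factorial + b₀ ^ (2 * d + (k + 1) * D) * Real.exp (ρ₃ * b₀ ^ (3 / 2 : ℝ))) * (Real.exp (-(ρ₃ * b ^ (3 / 2 : ℝ))) * Real.exp (ρ₄ * A * b ^ ρ₃)) := by positivity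
  have hfin := le_errTerm_of_le_snd (ρ₁ := ρ₁) (ρ₂ := ρ₂) (t := t) (le_refl ((2 ^ (k + 1) * (Φ) * (E * 2 ^ d * SwD) * (E * g * S1D) ^ k) * (k + 1).factorial * ((2 * d + (k + 1) * D).factorial + b₀ ^ (2 * d + (k + 1) * D) * Real.exp (ρ₃ * b₀ ^ (3 / 2 : ℝ))) * (Real.exp (-(ρ₃ * b ^ (3 / 2 : ℝ))) * Real.exp (ρ₄ * A * b ^ ρ₃)))) hS0' hA hb0
  calc (2 ^ (k + 1) * (ΦK)) * (A * E * Real.exp (-((κ / 2 - δ / 2 * ((D : ℝ) ^ 2 * Real.sqrt d)) / 2 * w)) * N * Sws) * (A * E * g * S1s) ^ k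
      ≤ ((2 ^ (k + 1) * (Φ) * (E * 2 ^ d * SwD) * (E * g * S1D) ^ k) * b ^ (2 * d + (k + 1) * D) * A ^ (k + 1) * Real.exp (-((κ / 2 - δ / 2 * ((D : ℝ) ^ 2 * Real.sqrt d)) / 2 * ((w : ℝ))))) * nI := hkey
    _ ≤ ((2 ^ (k + 1) * (Φ) * (E * 2 ^ d * SwD) * (E * g * S1D) ^ k) * (k + 1).factorial * ((2 * d + (k + 1) * D).factorial + b₀ ^ (2 * d + (k + 1) * D) * Real.exp (ρ₃ * b₀ ^ (3 / 2 : ℝ))) * (Real.exp (-(ρ₃ * b ^ (3 / 2 : ℝ))) * Real.exp (ρ₄ * A * b ^ ρ₃))) * nI := mul_le_mul_of_nonneg_right hatom hnI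
    _ = nI * ((2 ^ (k + 1) * (Φ) * (E * 2 ^ d * SwD) * (E * g * S1D) ^ k) * (k + 1).factorial * ((2 * d + (k + 1) * D).factorial + b₀ ^ (2 * d + (k + 1) * D) * Real.exp (ρ₃ * b₀ ^ (3 / 2 : ℝ))) * (Real.exp (-(ρ₃ * b ^ (3 / 2 : ℝ))) * Real.exp (ρ₄ * A * b ^ ρ₃))) := by ring
    _ ≤ _ := mul_le_mul_of_nonneg_left hfin hnI'


set_option maxHeartbeats 400000 in -- long `calc`/closed-term elaboration (ops-buildfix 2026-08-27: keep ≥ 2× headroom)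
/-- **ATOM (e) — the CROSS term `Φ·N·(k+1)k·(A·E·L^dg·Σ₁)·(A·E·e^{−(δ/(4(k+1)))(w+v+1)}·L^dg′·Σ₁)·(A·E·L^dg·Σ₁)^{k−1}` (print: `N = |B_k| ≤ |I|`;
the sibling `abs_cross_le_closed` at the assembler's palette) fits the SECOND summand in both regimes, CLASS EDITION with the row `0 ≤ K₀ ≤ C_K0·b`** (rate `δ/(2(k+1))/2`, `X = w + v + 1`;
multiplicity `m = k − 1 + 2`, so no case split at `k = 0`): `≤ nI·(C·m!·((2dm)! + b₀^{2dm}e^{ρ₃b₀^{3/2}}))·e^{−ρ₃b^{3/2}}e^{ρ₄Ab^{ρ₃}}` given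
`b₀ ≤ b → M·b^{3/2} ≤ v` and `ρ₃ + 1 ≤ (δ/(2(k+1))/2)·M`. [cite: BenfattoEtAl1978, (5.35) p.159, Appendix D p.165, (4.7) p.152; Balaban1985BackgroundPropagators, Sect. E p.428 (class form; ours)] -/
theorem cum_e_class_le (hA : 0 ≤ A) (hb : 1 ≤ b) (hL : ((L : ℕ) : ℝ) ≤ 2 * b ^ 2) (hδ : 0 ≤ δ) (hκ' : 0 ≤ κ / 2 - δ / 2 * ((D : ℝ) ^ 2 * Real.sqrt d))
    (hb₀ : 0 ≤ b₀) (hρ₃ : 0 ≤ ρ₃) (hρ₄ : 1 ≤ ρ₄) (hK₀ : 0 ≤ K₀) (hK₀b : K₀ ≤ CK0 * b) (hN0 : 0 ≤ N) (hNle : N ≤ nI) {k : ℕ}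
    (hreg : b₀ ≤ b → M * b ^ (3 / 2 : ℝ) ≤ (v : ℝ)) (hM : ρ₃ + 1 ≤ δ / (2 * ((k + 1 : ℕ) : ℝ)) / 2 * M) :
    2 ^ ((k + 1) * D) * 2 ^ 2 ^ ((k + 1) * D) * K₀ ^ ((k + 1) * D) * (N * (((k + 1 : ℕ) : ℝ) * (k : ℝ) * ((A * Real.exp (δ / 2 * ((D : ℝ) ^ 2 * d)) * (((L : ℕ) : ℝ) ^ d * (2 / (1 - Real.exp (-(δ / (2 * ((k + 1 : ℕ) : ℝ)) / Real.sqrt d))) * Real.exp (δ / (2 * ((k + 1 : ℕ) : ℝ)) / Real.sqrt d)) ^ d) * ∑ p ∈ Finset.Icc 1 s, ((admissible p D).card : ℝ) * ((2 / (1 - Real.exp (-((κ / 2 - δ / 2 * ((D : ℝ) ^ 2 * Real.sqrt d)) / (p : ℕ) / Real.sqrt d))) * Real.exp ((κ / 2 - δ / 2 * ((D : ℝ) ^ 2 * Real.sqrt d)) / (p : ℕ) / Real.sqrt d)) ^ d) ^ (p - 1)) * ((A * Real.exp (δ / 2 * ((D : ℝ) ^ 2 * d)) * Real.exp (-(δ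 / (2 * ((k + 1 : ℕ) : ℝ)) / 2 * ((w : ℝ) + v + 1))) * (((L : ℕ) : ℝ) ^ d * (2 / (1 - Real.exp (-(δ / (2 * ((k + 1 : ℕ) : ℝ)) / 2 / Real.sqrt d))) * Real.exp (δ / (2 * ((k + 1 : ℕ) : ℝ)) / 2 / Real.sqrt d)) ^ d) * ∑ p ∈ Finset.Icc 1 s, ((admissible p D).card : ℝ) * ((2 / (1 - Real.exp (-((κ / 2 - δ / 2 * ((D : ℝ) ^ 2 * Real.sqrt d)) / (p : ℕ) / Real.sqrt d))) * Real.exp ((κ / 2 - δ / 2 * ((D : ℝ) ^ 2 * Real.sqrt d)) / (p : ℕ) / Real.sqrt d)) ^ d) ^ (p - 1)) * (A * Real.exp (δ / 2 * ((D : ℝ) ^ 2 * d)) * (((L : ℕ) : ℝ) ^ d * (2 / (1 - Real.exp (-(δ / (2 * ((k + 1 : ℕ) : ℝ)) / Real.sqrt d))) * Real.exp (δ / (2 * ((k + 1 : ℕ) : ℝ)) / Real.sqrt d)) ^ d) * ∑ p ∈ Finset.Icc 1 s, ((admissible p D).card : ℝ) * ((2 / (1 - Real.exp (-((κ / 2 -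 δ / 2 * ((D : ℝ) ^ 2 * Real.sqrt d)) / (p : ℕ) / Real.sqrt d))) * Real.exp ((κ / 2 - δ / 2 * ((D : ℝ) ^ 2 * Real.sqrt d)) / (p : ℕ) / Real.sqrt d)) ^ d) ^ (p - 1)) ^ (k - 1))))) ≤
      nI * errTerm (((2 ^ ((k + 1) * D) * 2 ^ 2 ^ ((k + 1) * D) * CK0 ^ ((k + 1) * D)) * (((k + 1 : ℕ) : ℝ) * (k : ℝ)) * ((Real.exp (δ / 2 * ((D : ℝ) ^ 2 * d)) * (2 ^ d * (2 / (1 - Real.exp (-(δ / (2 * ((k + 1 : ℕ) : ℝ)) / Real.sqrt d))) * Real.exp (δ / (2 * ((k + 1 : ℕ) : ℝ)) / Real.sqrt d)) ^ d) * ∑ p ∈ Finset.Icc 1 D, ((admissible p D).card : ℝ) * ((2 / (1 - Real.exp (-((κ / 2 - δ / 2 * ((D : ℝ) ^ 2 * Real.sqrt d)) / (p : ℕ) / Real.sqrt d))) * Real.exp ((κ / 2 - δ / 2 * ((D : ℝ) ^ 2 * Real.sqrt d)) / (p : ℕ) / Real.sqrt d)) ^ d) ^ (p - 1)) * (Real.exp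 (δ / 2 * ((D : ℝ) ^ 2 * d)) * (2 ^ d * (2 / (1 - Real.exp (-(δ / (2 * ((k + 1 : ℕ) : ℝ)) / 2 / Real.sqrt d))) * Real.exp (δ / (2 * ((k + 1 : ℕ) : ℝ)) / 2 / Real.sqrt d)) ^ d) * ∑ p ∈ Finset.Icc 1 D, ((admissible p D).card : ℝ) * ((2 / (1 - Real.exp (-((κ / 2 - δ / 2 * ((D : ℝ) ^ 2 * Real.sqrt d)) / (p : ℕ) / Real.sqrt d))) * Real.exp ((κ / 2 - δ / 2 * ((D : ℝ) ^ 2 * Real.sqrt d)) / (p : ℕ) / Real.sqrt d)) ^ d) ^ (p - 1)) * (Real.exp (δ / 2 * ((D : ℝ) ^ 2 * d)) * (2 ^ d * (2 / (1 - Real.exp (-(δ / (2 * ((k + 1 : ℕ) : ℝ)) / Real.sqrt d))) * Real.exp (δ / (2 * ((k + 1 : ℕ) : ℝ)) / Real.sqrt d)) ^ d) * ∑ p ∈ Finset.Icc 1 D, ((admissible p D).card : ℝ) * ((2 / (1 - Real.exp (-((κ / 2 - δ / 2 * ((D : ℝ) ^ 2 * Real.sqrt d)) / (p : ℕ) / Real.sqrt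 d))) * Real.exp ((κ / 2 - δ / 2 * ((D : ℝ) ^ 2 * Real.sqrt d)) / (p : ℕ) / Real.sqrt d)) ^ d) ^ (p - 1)) ^ (k - 1))) * (k - 1 + 2).factorial * ((2 * d * (k - 1 + 2) + (k + 1) * D).factorial + b₀ ^ (2 * d * (k - 1 + 2) + (k + 1) * D) * Real.exp (ρ₃ * b₀ ^ (3 / 2 : ℝ)))) ρ₁ ρ₂ ρ₃ ρ₄ A b t := by
  have hb0 : 0 ≤ b := zero_le_one.trans hb
  have hCK0 : 0 ≤ CK0 := le_of_mul_le_mul_right (by simpa using hK₀.trans hK₀b) (by linarith : (0 : ℝ) < b)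
  have hκ'2 : 0 ≤ (κ / 2 - δ / 2 * ((D : ℝ) ^ 2 * Real.sqrt d)) / 2 := by linarith
  obtain ⟨hSw0, hSwle⟩ := sum_adm_geom_nonneg_le hκ'2 s D d
  obtain ⟨hSwD0, -⟩ := sum_adm_geom_nonneg_le hκ'2 D D d
  obtain ⟨hS10, hS1le⟩ := sum_adm_geom_nonneg_le hκ' s D d
  obtain ⟨hS1D0, -⟩ := sum_adm_geom_nonneg_le hκ' D D d
  set Sws := ∑ p ∈ Finset.Icc 1 s, ((admissible p D).card : ℝ) * ((2 / (1 - Real.exp (-((κ / 2 - δ / 2 * ((D : ℝ) ^ 2 * Real.sqrt d)) / 2 / (p : ℕ) / Real.sqrt d))) * Real.exp ((κ / 2 - δ / 2 * ((D : ℝ) ^ 2 * Real.sqrt d)) / 2 / (p : ℕ) / Real.sqrt d)) ^ d) ^ (p - 1) with hSws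
  set SwD := ∑ p ∈ Finset.Icc 1 D, ((admissible p D).card : ℝ) * ((2 / (1 - Real.exp (-((κ / 2 - δ / 2 * ((D : ℝ) ^ 2 * Real.sqrt d)) / 2 / (p : ℕ) / Real.sqrt d))) * Real.exp ((κ / 2 - δ / 2 * ((D : ℝ) ^ 2 * Real.sqrt d)) / 2 / (p : ℕ) / Real.sqrt d)) ^ d) ^ (p - 1) with hSwD
  clear_value Sws SwD
  set S1s := ∑ p ∈ Finset.Icc 1 s, ((admissible p D).card : ℝ) * ((2 / (1 - Real.exp (-((κ / 2 - δ / 2 * ((D : ℝ) ^ 2 * Real.sqrt d)) / (p : ℕ) / Real.sqrt d))) * Real.exp ((κ / 2 - δ / 2 * ((D : ℝ) ^ 2 * Real.sqrt d)) / (p : ℕ) / Real.sqrt d)) ^ d) ^ (p - 1) with hS1s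
  set S1D := ∑ p ∈ Finset.Icc 1 D, ((admissible p D).card : ℝ) * ((2 / (1 - Real.exp (-((κ / 2 - δ / 2 * ((D : ℝ) ^ 2 * Real.sqrt d)) / (p : ℕ) / Real.sqrt d))) * Real.exp ((κ / 2 - δ / 2 * ((D : ℝ) ^ 2 * Real.sqrt d)) / (p : ℕ) / Real.sqrt d)) ^ d) ^ (p - 1) with hS1D
  clear_value S1s S1D
  set ΦK : ℝ := 2 ^ ((k + 1) * D) * 2 ^ 2 ^ ((k + 1) * D) * K₀ ^ ((k + 1) * D) with hΦK
  set Φ : ℝ := 2 ^ ((k + 1) * D) * 2 ^ 2 ^ ((k + 1) * D) * CK0 ^ ((k + 1) * D) with hΦ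
  have hΦK0 : 0 ≤ ΦK := by rw [hΦK]; positivity
  have hΦ0 : 0 ≤ Φ := by rw [hΦ]; positivity
  have hΦle : ΦK ≤ Φ * b ^ ((k + 1) * D) := by
    rw [hΦK, hΦ, mul_assoc (2 ^ ((k + 1) * D) * 2 ^ 2 ^ ((k + 1) * D)) (CK0 ^ ((k + 1) * D)), ← mul_pow]
    exact mul_le_mul_of_nonneg_left (pow_le_pow_left₀ hK₀ hK₀b _) (by positivity)
  clear_value ΦK Φ
  set E : ℝ := Real.exp (δ / 2 * ((D : ℝ) ^ 2 * d)) with hE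
  have hE0 : 0 ≤ E := by rw [hE]; exact (Real.exp_pos _).le
  clear_value E
  set g : ℝ := (2 / (1 - Real.exp (-(δ / (2 * ((k + 1 : ℕ) : ℝ)) / Real.sqrt d))) * Real.exp (δ / (2 * ((k + 1 : ℕ) : ℝ)) / Real.sqrt d)) ^ d with hg
  have hg0 : 0 ≤ g := by rw [hg]; exact pow_nonneg (geom_nonneg' (by positivity)) d
  clear_value g
  have hLd := side_pow_le hL d
  have hLd0 : 0 ≤ ((L : ℕ) : ℝ) ^ d := by positivity
  set g' : ℝ := (2 / (1 - Real.exp (-(δ / (2 * ((k + 1 : ℕ) : ℝ)) / 2 / Real.sqrt d))) * Real.exp (δ / (2 * ((k + 1 : ℕ) : ℝ)) / 2 / Real.sqrt d)) ^ d with hg'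
  have hg'0 : 0 ≤ g' := by rw [hg']; exact pow_nonneg (geom_nonneg' (by positivity)) d
  clear_value g'
  have hc0 : 0 ≤ δ / (2 * ((k + 1 : ℕ) : ℝ)) / 2 := by positivity
  have hX0 : 0 ≤ (w : ℝ) + v + 1 := by positivity
  have hreg' : b₀ ≤ b → M * b ^ (3 / 2 : ℝ) ≤ (w : ℝ) + v + 1 := fun h => (hreg h).trans (by linarith [(Nat.cast_nonneg w : (0 : ℝ) ≤ w)])
  have hunit : A * E * (((L : ℕ) : ℝ) ^ d * g) * S1s ≤ A * E * (2 ^ d * b ^ (2 * d) * g) * S1D := by gcongr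
  have hunit0 : 0 ≤ A * E * (((L : ℕ) : ℝ) ^ d * g) * S1s := by positivity
  have hpow : (A * E * (((L : ℕ) : ℝ) ^ d * g) * S1s) ^ (k - 1) ≤ (A * E * (2 ^ d * b ^ (2 * d) * g) * S1D) ^ (k - 1) := pow_le_pow_left₀ hunit0 hunit _
  have hnI' : 0 ≤ nI := hN0.trans hNle
  have hkey : ΦK * (N * (((k + 1 : ℕ) : ℝ) * (k : ℝ) * ((A * E * (((L : ℕ) : ℝ) ^ d * g) * S1s) * ((A * E * Real.exp (-(δ / (2 * ((k + 1 : ℕ) : ℝ)) / 2 * ((w : ℝ) + v + 1))) * (((L : ℕ) : ℝ) ^ d * g') * S1s) * (A * E * (((L : ℕ) : ℝ) ^ d * g) * S1s) ^ (k - 1))))) ≤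
      (((Φ) * (((k + 1 : ℕ) : ℝ) * (k : ℝ)) * ((E * (2 ^ d * g) * S1D) * (E * (2 ^ d * g') * S1D) * (E * (2 ^ d * g) * S1D) ^ (k - 1))) * b ^ (2 * d * (k - 1 + 2) + (k + 1) * D) * A ^ (k - 1 + 2) * Real.exp (-(δ / (2 * ((k + 1 : ℕ) : ℝ)) / 2 * ((w : ℝ) + v + 1)))) * N := by
    calc ΦK * (N * (((k + 1 : ℕ) : ℝ) * (k : ℝ) * ((A * E * (((L : ℕ) : ℝ) ^ d * g) * S1s) * ((A * E * Real.exp (-(δ / (2 * ((k + 1 : ℕ) : ℝ)) / 2 * ((w : ℝ) + v + 1))) * (((L : ℕ) : ℝ) ^ d * g') * S1s) * (A * E * (((L : ℕ) : ℝ) ^ d * g) * S1s) ^ (k - 1)))))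
        ≤ (Φ * b ^ ((k + 1) * D)) * (N * (((k + 1 : ℕ) : ℝ) * (k : ℝ) * ((A * E * (2 ^ d * b ^ (2 * d) * g) * S1D) * ((A * E * Real.exp (-(δ / (2 * ((k + 1 : ℕ) : ℝ)) / 2 * ((w : ℝ) + v + 1))) * (2 ^ d * b ^ (2 * d) * g') * S1D) * (A * E * (2 ^ d * b ^ (2 * d) * g) * S1D) ^ (k - 1))))) := by gcongr
      _ = _ := by ring
  have hatom := decay_atom_le_snd (A := A) (b := b) (b₀ := b₀) (ρ₃ := ρ₃) (ρ₄ := ρ₄)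
    (C := (Φ) * (((k + 1 : ℕ) : ℝ) * (k : ℝ)) * ((E * (2 ^ d * g) * S1D) * (E * (2 ^ d * g') * S1D) * (E * (2 ^ d * g) * S1D) ^ (k - 1))) (c := δ / (2 * ((k + 1 : ℕ) : ℝ)) / 2) (X := (w : ℝ) + v + 1) (M := M)
    (by positivity) hA hb hb₀ hρ₃ hρ₄ hc0 hX0 hreg' hM (2 * d * (k - 1 + 2) + (k + 1) * D) (k - 1 + 2)
  have hS0' : 0 ≤ ((Φ) * (((k + 1 : ℕ) : ℝ) * (k : ℝ)) * ((E * (2 ^ d * g) * S1D) * (E * (2 ^ d * g') * S1D) * (E * (2 ^ d * g) * S1D) ^ (k - 1))) * (k - 1 + 2).factorial * ((2 * d * (k - 1 + 2) + (k + 1) * D).factorial + b₀ ^ (2 * d * (k - 1 + 2) + (k + 1) * D) * Real.exp (ρ₃ * b₀ ^ (3 / 2 : ℝ))) := by positivity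
  have hS0 : 0 ≤ ((Φ) * (((k + 1 : ℕ) : ℝ) * (k : ℝ)) * ((E * (2 ^ d * g) * S1D) * (E * (2 ^ d * g') * S1D) * (E * (2 ^ d * g) * S1D) ^ (k - 1))) * (k - 1 + 2).factorial * ((2 * d * (k - 1 + 2) + (k + 1) * D).factorial + b₀ ^ (2 * d * (k - 1 + 2) + (k + 1) * D) * Real.exp (ρ₃ * b₀ ^ (3 / 2 : ℝ))) * (Real.exp (-(ρ₃ * b ^ (3 / 2 : ℝ))) * Real.exp (ρ₄ * A * b ^ ρ₃)) := by positivity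
  have hfin := le_errTerm_of_le_snd (ρ₁ := ρ₁) (ρ₂ := ρ₂) (t := t) (le_refl (((Φ) * (((k + 1 : ℕ) : ℝ) * (k : ℝ)) * ((E * (2 ^ d * g) * S1D) * (E * (2 ^ d * g') * S1D) * (E * (2 ^ d * g) * S1D) ^ (k - 1))) * (k - 1 + 2).factorial * ((2 * d * (k - 1 + 2) + (k + 1) * D).factorial + b₀ ^ (2 * d * (k - 1 + 2) + (k + 1) * D) * Real.exp (ρ₃ * b₀ ^ (3 / 2 : ℝ))) * (Real.exp (-(ρ₃ * b ^ (3 / 2 : ℝ))) * Real.exp (ρ₄ * A * b ^ ρ₃)))) hS0' hA hb0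
  calc ΦK * (N * (((k + 1 : ℕ) : ℝ) * (k : ℝ) * ((A * E * (((L : ℕ) : ℝ) ^ d * g) * S1s) * ((A * E * Real.exp (-(δ / (2 * ((k + 1 : ℕ) : ℝ)) / 2 * ((w : ℝ) + v + 1))) * (((L : ℕ) : ℝ) ^ d * g') * S1s) * (A * E * (((L : ℕ) : ℝ) ^ d * g) * S1s) ^ (k - 1)))))
      ≤ (((Φ) * (((k + 1 : ℕ) : ℝ) * (k : ℝ)) * ((E * (2 ^ d * g) * S1D) * (E * (2 ^ d * g') * S1D) * (E * (2 ^ d * g) * S1D) ^ (k - 1))) * b ^ (2 * d * (k - 1 + 2) + (k + 1) * D) * A ^ (k - 1 + 2) * Real.exp (-(δ / (2 * ((k + 1 : ℕ) : ℝ)) / 2 * ((w : ℝ) + v + 1)))) * N := hkey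
    _ ≤ (((Φ) * (((k + 1 : ℕ) : ℝ) * (k : ℝ)) * ((E * (2 ^ d * g) * S1D) * (E * (2 ^ d * g') * S1D) * (E * (2 ^ d * g) * S1D) ^ (k - 1))) * (k - 1 + 2).factorial * ((2 * d * (k - 1 + 2) + (k + 1) * D).factorial + b₀ ^ (2 * d * (k - 1 + 2) + (k + 1) * D) * Real.exp (ρ₃ * b₀ ^ (3 / 2 : ℝ))) * (Real.exp (-(ρ₃ * b ^ (3 / 2 : ℝ))) * Real.exp (ρ₄ * A * b ^ ρ₃))) * nI := mul_le_mul hatom hNle hN0 hS0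
    _ = nI * (((Φ) * (((k + 1 : ℕ) : ℝ) * (k : ℝ)) * ((E * (2 ^ d * g) * S1D) * (E * (2 ^ d * g') * S1D) * (E * (2 ^ d * g) * S1D) ^ (k - 1))) * (k - 1 + 2).factorial * ((2 * d * (k - 1 + 2) + (k + 1) * D).factorial + b₀ ^ (2 * d * (k - 1 + 2) + (k + 1) * D) * Real.exp (ρ₃ * b₀ ^ (3 / 2 : ℝ))) * (Real.exp (-(ρ₃ * b ^ (3 / 2 : ℝ))) * Real.exp (ρ₄ * A * b ^ ρ₃))) := by ring
    _ ≤ _ := mul_le_mul_of_nonneg_left hfin hnI'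


set_option maxHeartbeats 400000 in -- long `calc`/closed-term elaboration (ops-buildfix 2026-08-27: keep ≥ 2× headroom)
/-- **ATOM (f) — the within-box term `W₂₉`: `N·3^{k+1}·Φ·e^{−(δ/2)(v+1)}·(A·E·L^d·Σ₁)^{k+1}` (print: `N = |B_k| ≤ |I|`) fits the SECOND summand in
both regimes, CLASS EDITION with the row `0 ≤ K₀ ≤ C_K0·b`** (rate `δ/2`, `X = v + 1`): `≤ nI·(C·(k+1)!·((2d(k+1))! + b₀^{2d(k+1)}e^{ρ₃b₀^{3/2}}))·e^{−ρ₃b^{3/2}}e^{ρ₄Ab^{ρ₃}}`.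
[cite: BenfattoEtAl1978, (5.29) p.157, (5.35) p.159, Appendix D p.165, (4.7) p.152; Balaban1985BackgroundPropagators, Sect. E p.428 (class form; ours)] -/
theorem cum_f_class_le (hA : 0 ≤ A) (hb : 1 ≤ b) (hL : ((L : ℕ) : ℝ) ≤ 2 * b ^ 2) (hδ : 0 ≤ δ) (hκ' : 0 ≤ κ / 2 - δ / 2 * ((D : ℝ) ^ 2 * Real.sqrt d))
    (hb₀ : 0 ≤ b₀) (hρ₃ : 0 ≤ ρ₃) (hρ₄ : 1 ≤ ρ₄) (hK₀ : 0 ≤ K₀) (hK₀b : K₀ ≤ CK0 * b) (hN0 : 0 ≤ N) (hNle : N ≤ nI)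
    (hreg : b₀ ≤ b → M * b ^ (3 / 2 : ℝ) ≤ (v : ℝ)) (hM : ρ₃ + 1 ≤ δ / 2 * M) (k : ℕ) :
    N * ((3 : ℝ) ^ (k + 1) * (2 ^ ((k + 1) * D) * 2 ^ 2 ^ ((k + 1) * D) * K₀ ^ ((k + 1) * D) * Real.exp (-(δ / 2 * ((v : ℝ) + 1))) * (A * Real.exp (δ / 2 * ((D : ℝ) ^ 2 * d)) * ((L : ℕ) : ℝ) ^ d * ∑ p ∈ Finset.Icc 1 s, ((admissible p D).card : ℝ) * ((2 / (1 - Real.exp (-((κ / 2 - δ / 2 * ((D : ℝ) ^ 2 * Real.sqrt d)) / (p : ℕ) / Real.sqrt d))) * Real.exp ((κ / 2 - δ / 2 * ((D : ℝ) ^ 2 * Real.sqrt d)) / (p : ℕ) / Real.sqrt d)) ^ d) ^ (p - 1)) ^ (k + 1))) ≤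
      nI * errTerm (((3 : ℝ) ^ (k + 1) * (2 ^ ((k + 1) * D) * 2 ^ 2 ^ ((k + 1) * D) * CK0 ^ ((k + 1) * D)) * (Real.exp (δ / 2 * ((D : ℝ) ^ 2 * d)) * 2 ^ d * ∑ p ∈ Finset.Icc 1 D, ((admissible p D).card : ℝ) * ((2 / (1 - Real.exp (-((κ / 2 - δ / 2 * ((D : ℝ) ^ 2 * Real.sqrt d)) / (p : ℕ) / Real.sqrt d))) * Real.exp ((κ / 2 - δ / 2 * ((D : ℝ) ^ 2 * Real.sqrt d)) / (p : ℕ) / Real.sqrt d)) ^ d) ^ (p - 1)) ^ (k + 1)) * (k + 1).factorial * ((2 * d * (k + 1) + (k + 1) * D).factorial + b₀ ^ (2 * d * (k + 1) + (k + 1) * D) * Real.exp (ρ₃ * b₀ ^ (3 / 2 : ℝ)))) ρ₁ ρ₂ ρ₃ ρ₄ A b t := by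
  have hb0 : 0 ≤ b := zero_le_one.trans hb
  have hCK0 : 0 ≤ CK0 := le_of_mul_le_mul_right (by simpa using hK₀.trans hK₀b) (by linarith : (0 : ℝ) < b)
  have hκ'2 : 0 ≤ (κ / 2 - δ / 2 * ((D : ℝ) ^ 2 * Real.sqrt d)) / 2 := by linarith
  obtain ⟨hSw0, hSwle⟩ := sum_adm_geom_nonneg_le hκ'2 s D d
  obtain ⟨hSwD0, -⟩ := sum_adm_geom_nonneg_le hκ'2 D D d
  obtain ⟨hS10, hS1le⟩ := sum_adm_geom_nonneg_le hκ' s D d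
  obtain ⟨hS1D0, -⟩ := sum_adm_geom_nonneg_le hκ' D D d
  set Sws := ∑ p ∈ Finset.Icc 1 s, ((admissible p D).card : ℝ) * ((2 / (1 - Real.exp (-((κ / 2 - δ / 2 * ((D : ℝ) ^ 2 * Real.sqrt d)) / 2 / (p : ℕ) / Real.sqrt d))) * Real.exp ((κ / 2 - δ / 2 * ((D : ℝ) ^ 2 * Real.sqrt d)) / 2 / (p : ℕ) / Real.sqrt d)) ^ d) ^ (p - 1) with hSws
  set SwD := ∑ p ∈ Finset.Icc 1 D, ((admissible p D).card : ℝ) * ((2 / (1 - Real.exp (-((κ / 2 - δ / 2 * ((D : ℝ) ^ 2 * Real.sqrt d)) / 2 / (p : ℕ) / Real.sqrt d))) * Real.exp ((κ / 2 - δ / 2 * ((D : ℝ) ^ 2 * Real.sqrt d)) / 2 / (p : ℕ) / Real.sqrt d)) ^ d) ^ (p - 1) with hSwD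
  clear_value Sws SwD
  set S1s := ∑ p ∈ Finset.Icc 1 s, ((admissible p D).card : ℝ) * ((2 / (1 - Real.exp (-((κ / 2 - δ / 2 * ((D : ℝ) ^ 2 * Real.sqrt d)) / (p : ℕ) / Real.sqrt d))) * Real.exp ((κ / 2 - δ / 2 * ((D : ℝ) ^ 2 * Real.sqrt d)) / (p : ℕ) / Real.sqrt d)) ^ d) ^ (p - 1) with hS1s
  set S1D := ∑ p ∈ Finset.Icc 1 D, ((admissible p D).card : ℝ) * ((2 / (1 - Real.exp (-((κ / 2 - δ / 2 * ((D : ℝ) ^ 2 * Real.sqrt d)) / (p : ℕ) / Real.sqrt d))) * Real.exp ((κ / 2 - δ / 2 * ((D : ℝ) ^ 2 * Real.sqrt d)) / (p : ℕ) / Real.sqrt d)) ^ d) ^ (p - 1) with hS1D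
  clear_value S1s S1D
  set ΦK : ℝ := 2 ^ ((k + 1) * D) * 2 ^ 2 ^ ((k + 1) * D) * K₀ ^ ((k + 1) * D) with hΦK
  set Φ : ℝ := 2 ^ ((k + 1) * D) * 2 ^ 2 ^ ((k + 1) * D) * CK0 ^ ((k + 1) * D) with hΦ
  have hΦK0 : 0 ≤ ΦK := by rw [hΦK]; positivity
  have hΦ0 : 0 ≤ Φ := by rw [hΦ]; positivity
  have hΦle : ΦK ≤ Φ * b ^ ((k + 1) * D) := by
    rw [hΦK, hΦ, mul_assoc (2 ^ ((k + 1) * D) * 2 ^ 2 ^ ((k + 1) * D)) (CK0 ^ ((k + 1) * D)), ← mul_pow]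
    exact mul_le_mul_of_nonneg_left (pow_le_pow_left₀ hK₀ hK₀b _) (by positivity)
  clear_value ΦK Φ
  set E : ℝ := Real.exp (δ / 2 * ((D : ℝ) ^ 2 * d)) with hE
  have hE0 : 0 ≤ E := by rw [hE]; exact (Real.exp_pos _).le
  clear_value E
  set g : ℝ := (2 / (1 - Real.exp (-(δ / (2 * ((k + 1 : ℕ) : ℝ)) / Real.sqrt d))) * Real.exp (δ / (2 * ((k + 1 : ℕ) : ℝ)) / Real.sqrt d)) ^ d with hg
  have hg0 : 0 ≤ g := by rw [hg]; exact pow_nonneg (geom_nonneg' (by positivity)) d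
  clear_value g
  have hLd := side_pow_le hL d
  have hLd0 : 0 ≤ ((L : ℕ) : ℝ) ^ d := by positivity
  have hc0 : 0 ≤ δ / 2 := by linarith
  have hX0 : 0 ≤ (v : ℝ) + 1 := by positivity
  have hreg' : b₀ ≤ b → M * b ^ (3 / 2 : ℝ) ≤ (v : ℝ) + 1 := fun h => (hreg h).trans (by linarith)
  have hunit : A * E * ((L : ℕ) : ℝ) ^ d * S1s ≤ A * E * (2 ^ d * b ^ (2 * d)) * S1D := by gcongr
  have hunit0 : 0 ≤ A * E * ((L : ℕ) : ℝ) ^ d * S1s := by positivity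
  have hpow : (A * E * ((L : ℕ) : ℝ) ^ d * S1s) ^ (k + 1) ≤ (A * E * (2 ^ d * b ^ (2 * d)) * S1D) ^ (k + 1) := pow_le_pow_left₀ hunit0 hunit _
  have hnI' : 0 ≤ nI := hN0.trans hNle
  have hkey : N * ((3 : ℝ) ^ (k + 1) * (ΦK * Real.exp (-(δ / 2 * ((v : ℝ) + 1))) * (A * E * ((L : ℕ) : ℝ) ^ d * S1s) ^ (k + 1))) ≤
      (((3 : ℝ) ^ (k + 1) * (Φ) * (E * 2 ^ d * S1D) ^ (k + 1)) * b ^ (2 * d * (k + 1) + (k + 1) * D) * A ^ (k + 1) * Real.exp (-(δ / 2 * ((v : ℝ) + 1)))) * N := by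
    calc N * ((3 : ℝ) ^ (k + 1) * (ΦK * Real.exp (-(δ / 2 * ((v : ℝ) + 1))) * (A * E * ((L : ℕ) : ℝ) ^ d * S1s) ^ (k + 1)))
        ≤ N * ((3 : ℝ) ^ (k + 1) * ((Φ * b ^ ((k + 1) * D)) * Real.exp (-(δ / 2 * ((v : ℝ) + 1))) * (A * E * (2 ^ d * b ^ (2 * d)) * S1D) ^ (k + 1))) := by gcongr
      _ = _ := by ring
  have hatom := decay_atom_le_snd (A := A) (b := b) (b₀ := b₀) (ρ₃ := ρ₃) (ρ₄ := ρ₄)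
    (C := (3 : ℝ) ^ (k + 1) * (Φ) * (E * 2 ^ d * S1D) ^ (k + 1)) (c := δ / 2) (X := (v : ℝ) + 1) (M := M)
    (by positivity) hA hb hb₀ hρ₃ hρ₄ hc0 hX0 hreg' hM (2 * d * (k + 1) + (k + 1) * D) (k + 1)
  have hS0' : 0 ≤ ((3 : ℝ) ^ (k + 1) * (Φ) * (E * 2 ^ d * S1D) ^ (k + 1)) * (k + 1).factorial * ((2 * d * (k + 1) + (k + 1) * D).factorial + b₀ ^ (2 * d * (k + 1) + (k + 1) * D) * Real.exp (ρ₃ * b₀ ^ (3 / 2 : ℝ))) := by positivity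
  have hS0 : 0 ≤ ((3 : ℝ) ^ (k + 1) * (Φ) * (E * 2 ^ d * S1D) ^ (k + 1)) * (k + 1).factorial * ((2 * d * (k + 1) + (k + 1) * D).factorial + b₀ ^ (2 * d * (k + 1) + (k + 1) * D) * Real.exp (ρ₃ * b₀ ^ (3 / 2 : ℝ))) * (Real.exp (-(ρ₃ * b ^ (3 / 2 : ℝ))) * Real.exp (ρ₄ * A * b ^ ρ₃)) := by positivity
  have hfin := le_errTerm_of_le_snd (ρ₁ := ρ₁) (ρ₂ := ρ₂) (t := t) (le_refl (((3 : ℝ) ^ (k + 1) * (Φ) * (E * 2 ^ d * S1D) ^ (k + 1)) * (k + 1).factorial * ((2 * d * (k + 1) + (k + 1) * D).factorial + b₀ ^ (2 * d * (k + 1) + (k + 1) * D) * Real.exp (ρ₃ * b₀ ^ (3 / 2 : ℝ))) * (Real.exp (-(ρ₃ * b ^ (3 / 2 : ℝ))) * Real.exp (ρ₄ * A * b ^ ρ₃)))) hS0' hA hb0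
  calc N * ((3 : ℝ) ^ (k + 1) * (ΦK * Real.exp (-(δ / 2 * ((v : ℝ) + 1))) * (A * E * ((L : ℕ) : ℝ) ^ d * S1s) ^ (k + 1)))
      ≤ (((3 : ℝ) ^ (k + 1) * (Φ) * (E * 2 ^ d * S1D) ^ (k + 1)) * b ^ (2 * d * (k + 1) + (k + 1) * D) * A ^ (k + 1) * Real.exp (-(δ / 2 * ((v : ℝ) + 1)))) * N := hkey
    _ ≤ (((3 : ℝ) ^ (k + 1) * (Φ) * (E * 2 ^ d * S1D) ^ (k + 1)) * (k + 1).factorial * ((2 * d * (k + 1) + (k + 1) * D).factorial + b₀ ^ (2 * d * (k + 1) + (k + 1) * D) * Real.exp (ρ₃ * b₀ ^ (3 / 2 : ℝ))) * (Real.exp (-(ρ₃ * b ^ (3 / 2 : ℝ))) * Real.exp (ρ₄ * A * b ^ ρ₃))) * nI := mul_le_mul hatom hNle hN0 hS0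
    _ = nI * (((3 : ℝ) ^ (k + 1) * (Φ) * (E * 2 ^ d * S1D) ^ (k + 1)) * (k + 1).factorial * ((2 * d * (k + 1) + (k + 1) * D).factorial + b₀ ^ (2 * d * (k + 1) + (k + 1) * D) * Real.exp (ρ₃ * b₀ ^ (3 / 2 : ℝ))) * (Real.exp (-(ρ₃ * b ^ (3 / 2 : ℝ))) * Real.exp (ρ₄ * A * b ^ ρ₃))) := by ring
    _ ≤ _ := mul_le_mul_of_nonneg_left hfin hnI'


end CumulantAtoms

end Literature.MathematicalPhysics.QuantumFieldTheory.Balaban1983to89.B1Eq324BenfattoKernelSect5LedgerCumulant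

end
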